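import Literature.MathematicalPhysics.QuantumFieldTheory.Balaban1983to89.B6Prop22KLevelTorusCensusL0
import Literature.MathematicalPhysics.QuantumFieldTheory.Balaban1983to89.B6Prop22DualHolderMultiLevelTorusL0
import Literature.MathematicalPhysics.QuantumFieldTheory.Balaban1983to89.B6Prop22KLevelCensusEtaL0
/-!
# `Balaban1983to89.B6Prop22KLevelTorusCensusEtaL0` — LEVEL-0 TWIN (programme G-F3′-L0, director-ym LINE №27 / UV3-NODE §24.5; plan `lit-balaban-r03/G-F3L0-PLAN.md`) of `B6Prop22KLevelTorusCensusEta`: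
the same declarations, SAME NAMES AND STATEMENTS, for nested families WITH print's region `Λ₀ = T ∖ Ω₁` ADMITTED (structures
`B6MultiLevelBoxOperatorL0.Domains` / `B6MultiLevelTorusOperatorL0.TDomains`: levels `0, …, k`, the level-`0` block a single site, `Q′₀ = id`,
finite weight `a₀` — print p.225 (2.14) «Σ_{j=0}^k … (Q′₀λ)(x) = λ(x), x ∈ Λ₀», p.229 «taking a sequence (2.1) … smallest possible domains B^j(Λ_j),
and considering the operator Δ_a defined by (2.19), (2.20) for this sequence»).  Every `D`-free object is the lineage's, consumed BY NAME; no existing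
module is touched; no fact is minted.  Unit `lit-balaban-p33` (S-B hands, p33 gen 88; packet S-B owner p21 gen 26; port tooling by r03 gen 36); B6 fold owner r03; referee ref-4.  THE TWIN'S DOCUMENTATION FOLLOWS
VERBATIM (its «levels 1 … k» / «Ω₁ = X» sentences describe the twin; here `j` runs from `0` and `Ω₁` may be a proper subset).

# `Balaban1983to89.B6Prop22KLevelTorusCensusEta` — [B6] PROPOSITION 2.2 IN THE CENSUS TYPING ON THE GENUINE `k`-LEVEL
# TORUS FAMILY `KTIdx` MEASURED IN PRINT'S UNITS `η = L^{−k}`, AND ITS HÖLDER CONJUNCT AT EACH `α` — all six entries of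
# (2.67), per `α`, on EVERY nested family (2.1)–(2.2) of the torus `T_η` (print's carrier, `Ω₁ = T_η`)
# (file T11 of the torus carrier; no existing module is touched; no fact is minted)

FRAMING (verbatim cell line):
statement-level skeleton of published theorems with citation tags; proofs where landed; nothing here is a claim about the Yang–Mills mass gap

Source under audit (cell pub-balaban / lit-balaban): T. Bałaban, *Propagators and renormalization transformations for
lattice gauge theories. II*, Commun. Math. Phys. **96** (1984) 223–250 [`Balaban1984PropagatorsII`, "B6"], p. 234
[PDF 12] Proposition 2.2 (2.67); p. 224 [PDF 2] (2.1)–(2.4) («Ω₁ ⊃ Ω₂ ⊃ … ⊃ Ω_k, Ω_j ⊂ T_η»; «we admit the case when some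
domains Ω_j are equal to T_η»); p. 231 [PDF 9] (2.46); [`Balaban1984PropagatorsI`] (1.109) p. 35 (the Hölder norm);
[`Balaban1983RegularityDecay`] Thm (1.9) p. 573.  Unit `lit-balaban-p21` (Phase-2 proof seat p21 gen 15), HOME
`run/shared/lean/pub/lit-balaban/`, B6 fold owner r03, referee ref-4.  Consumed BY NAME: file T8's census dictionary
`…B6Prop22KLevelTorusCensus` (`KTIdx`, `geoT`, `gp`, `prop22_supEntries_kLevelTorus`, non-vacuity), files T6/T7/T9/T10
(`prop22_second/third_multiLevelTorus`, `prop22_fourth/fifth_multiLevelTorus_unif`), and r03's print-unit rescaling vocabulary of the box family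
`…B6Prop22KLevelCensusEta` (`epow`, `pref4_rescale`, `eta_weight`).  The pattern is r03's `B6Prop22KLevelCensusEta`
(box family) transcribed to the torus family: the Hölder conjunct of the census sentence must be read in print's units
(`η = L^{−k}`, so `L^jη ≤ 1`), where print's product rule `‖ζF‖_α ≤ ‖ζ‖_α·sup|F| + |ζ|·‖F‖_α` closes.

## WHAT IS PRINTED (p. 234)

«**Proposition 2.2.** If we have (2.1), (2.2) and M is sufficiently large, then the operator G′ = Δ′_a^{−1} (a = 1)
satisfies the inequalities |(G′λ)(x)|, |(∇G′λ)(x)|, |(G′∇*λ)(x)|, ‖ζ∇G′λ‖_α, ‖ζG′∇*λ‖_α, |(ΔG′λ)(x)| ≤ O(1)[(L^jη)²,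
L^jη, L^jη, (L^jη)^{1−α}(‖ζ‖_α + |ζ|), (L^jη)^{1−α}(‖ζ‖_α + |ζ|), 1]e^{−½δ₀d(y,y′)}|λ|, x ∈ B^j(y) or supp ζ ⊂ B^j(y),
y ∈ Λ_j, supp λ ⊂ B^{j′}(y′), y′ ∈ Λ_{j′}. (2.67)».

## WHAT THIS FILE CERTIFIES (kernel-checked; 0 sorry)

* §1 the print-unit dictionary on `KTIdx`: `nKT = L^k`, the Hölder seminorm `hqTP` with the TORUS distance
  `|x′−x|_T·η`, the periodic bond function `dGT` (`∇^η_μG′^ηλ = η·((G′λ)(x+e_μ) − (G′λ)(x))`) and the site function `GdT`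
  (`G′^η∇^{η*}_μλ = η·(G′∂_μᵀλ)`), the Hölder slot `hHTP`, `geoTP` (`KTIdx.geoT` with `eta := L^{−k}`, `holder := hqTP`,
  `cutH := hqTP + |·|`), `gpTP` (entries `η²e₀, ηe₁, ηe₂, e₃`, Hölder slot `hHTP`); `geoTP_len`, `lenT_le_one`;
* §2 `prop22_supEntries_kLevelTorusP` — the FIRST CONJUNCT of `B6.Prop22Printed (geoTP) (gpTP)`, from file T8 by the
  exact rescaling `pref4 (L^jη) m = η^{(2,1,1,0)_m}·pref4 (L^j) m`;
* §3 Hölder plumbing with the torus distance (`one_le_torusSupNorm_sub`, `hqTP_nonneg`, `pair_le_hqTP`,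
  `quot_eq_weightT`, `hqTP_le_of_forall`, `hHTP_le_of_forall`, the product rule `holder_pair_boundTP`);
* §4 **`prop22_holderEntries_kLevelTorusP_unif`** — THE HÖLDER CONJUNCT with ONE threshold and ONE rate for ALL
  `0 ≤ α < 1` on the genuine `k`-level TORUS family in print's units (per-`α` form `prop22_holderEntries_kLevelTorusP`):
  `∃ M₁ δ₀ > 0 ∀ α ∃ C_α > 0 ∀ i, M₁ ≤ M → ∀ λ ζ y y′ (supp ζ ⊂ B(y), supp λ ⊂ B(y′)):
  max_μ max(‖ζ∇^η_μG′λ‖_α, ‖ζG′∇^{η*}_μλ‖_α) ≤ C·(L^jη)^{1−α}·(‖ζ‖_α + |ζ|)·e^{−½δ₀d_T(y,y′)}·|λ|` — from files T6/T7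
  (entries 2, 3 on `T_η`) and T9/T10 (entries 4, 5 on the pairs of one block of `T_η`) by the product rule, using
  `L^jη ≤ 1` exactly where print does;
* §5 **`prop22Printed_kLevelTorusP : Prop22Printed (fun i : KTIdx d ℓ => geoTP i) (fun i => gpTP i)`** — THE CENSUS
  SENTENCE OF PROP. 2.2 VERBATIM (`∃ M₁ δ₀ C, ∃ Cα : ℝ → ℝ, ∀ members, ∀ α`) on the genuine `k`-level TORUS family in
  print's units (and the per-`α` bundle `prop22Printed_kLevelTorusP_perAlpha`), and non-vacuity
  (`kLevelTorusP_nonvacuous`, `kLevelTorusP_nonvacuous3` — torus (2.2) ACTIVE —, `kLevelTorusP_top`).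

## HONEST SCOPE

(1) The census quantifier order `∃ (M₁, δ₀) ∀ α` is obtained from the `α`-uniform rates of files T9/T10 (the box
lineage's `…RateUnif` per-term lemmas read in the charts).  (2) As files T1–T10: levels `1 … k`, `Ω₁ = T_η`
(no level `0`/`a₀ = +∞`), `m² = 0`, `P_μ ≥ 4`, asymmetric partition, Neumann two-level cube inverses, the `L`-dependent
(2.61)-constant; the Hölder quotients over the pairs of ONE block with the torus distance, the factor `(‖ζ‖_α + |ζ|)`
produced by the product rule (cut-off supported in `B(y)`).  Nothing is inferred from the manuscript: every step is
kernel-checked.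
-/

noncomputable section

open scoped BigOperators
open Finset Matrix

namespace Literature.MathematicalPhysics.QuantumFieldTheory.Balaban1983to89.B6Prop22KLevelTorusCensusEtaL0

open Literature.MathematicalPhysics.QuantumFieldTheory.Balaban1983to89.B4ContourShift (supNorm abs_le_supNorm supNorm_nonneg)
open Literature.MathematicalPhysics.QuantumFieldTheory.Balaban1983to89.B4Reflection242 (boxDom mem_boxDom)
open Literature.MathematicalPhysics.QuantumFieldTheory.Balaban1983to89.B4TorusKernel.MultiPeriod (torusSupNorm circAbs
  torusSupNorm_nonneg)
open Literature.MathematicalPhysics.QuantumFieldTheory.Balaban1983to89.B6MultiLevelBoxOperator (N0 aPrinted aPrinted_window aPrinted_succ bigSide one_le_bigSide)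
open Literature.MathematicalPhysics.QuantumFieldTheory.Balaban1983to89.B6MultiLevelBoxOperatorL0 (Domains)
open Literature.MathematicalPhysics.QuantumFieldTheory.Balaban1983to89.B6Geom246MultiLevelBoxL0 (bset blkOf geom bond scale_bounds lev_eq_of_blkOf_eq)
open Literature.MathematicalPhysics.QuantumFieldTheory.Balaban1983to89.B6Ineq243TwoLevelBox (aNext)
open Literature.MathematicalPhysics.QuantumFieldTheory.Balaban1983to89.B6RandomWalk (HasMajorant BlockSupp)
open Literature.MathematicalPhysics.QuantumFieldTheory.Balaban1983to89.B6 (Geometry GpFamily Prop22Printed pref4)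
open Literature.MathematicalPhysics.QuantumFieldTheory.Balaban1983to89.B6MultiLevelTorusOperator hiding TDomains mlOpT_apply mlOpT_eq_reindex_chart mlOpT_mul_reindex mlOpT_tshift
open Literature.MathematicalPhysics.QuantumFieldTheory.Balaban1983to89.B6MultiLevelTorusOperatorL0
open Literature.MathematicalPhysics.QuantumFieldTheory.Balaban1983to89.B6Geom246MultiLevelTorus hiding TouchT blkHom blkMap blkMap_blkOf blkMap_injective blkMap_surjective blkOf_tshift_eq bondT bondT_adj bond_le_bondT connectedT csysT distT_le_dist_box distT_le_dist_chart dist_posT_le_of_adj dist_posT_le_of_touchT dist_site_posT_le geomT label_bounds lemma21_torus levelGapT packT posT realizesT touchT_symm triangle_refl_nonneg_T walk_dispT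
open Literature.MathematicalPhysics.QuantumFieldTheory.Balaban1983to89.B6Geom246MultiLevelTorusL0
open Literature.MathematicalPhysics.QuantumFieldTheory.Balaban1983to89.B6Prop22DerivMultiLevelTorus (dT dT_mulVec)
open Literature.MathematicalPhysics.QuantumFieldTheory.Balaban1983to89.B6Prop22DerivMultiLevelTorusL0 (prop22_second_multiLevelTorus)
open Literature.MathematicalPhysics.QuantumFieldTheory.Balaban1983to89.B6Prop22AdjMultiLevelTorusL0 (prop22_third_multiLevelTorus)
open Literature.MathematicalPhysics.QuantumFieldTheory.Balaban1983to89.B6Prop22HolderMultiLevelTorusL0 (prop22_fourth_multiLevelTorus_unif)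
open Literature.MathematicalPhysics.QuantumFieldTheory.Balaban1983to89.B6Prop22DualHolderMultiLevelTorusL0 (prop22_fifth_multiLevelTorus_unif)
open Literature.MathematicalPhysics.QuantumFieldTheory.Balaban1983to89.B6Prop22KLevelTorusCensusL0 (KTIdx prop22_supEntries_kLevelTorus kLevelTorus_nonvacuous kLevelTorus_nonvacuous3 kLevelTorus_top)
open Literature.MathematicalPhysics.QuantumFieldTheory.Balaban1983to89.B6Prop22KLevelCensusL0 (KIdx.aPrinted_windows)
open Literature.MathematicalPhysics.QuantumFieldTheory.Balaban1983to89.B6Prop22KLevelCensusEta (epow pref4_rescale eta_weight)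

variable {d : ℕ}

/-! ## §1 The print-unit dictionary on the `k`-level torus family -/

section Dictionary

variable {ℓ : ℕ} (i : KTIdx d ℓ)

/-- `n = L^k`: the number of fine sites per coarsest block side; print's `η = L^{−k}` in units where the coarsest blocks
(level `k`) are unit cubes (`L^kη = 1`). [cite: Balaban1984PropagatorsII, (2.1) p.224 (the lattices `T^{(j)}_{L^jη}`), dictionary] -/
def nKT : ℕ := (ℓ + 1) ^ i.k

/-- `1 ≤ L^k`. [cite: Balaban1984PropagatorsII, (2.1) p.224, dictionary] -/
theorem one_le_nKT : 1 ≤ nKT i := Nat.one_le_pow _ _ (by omega)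

/-- `0 < L^k` (as a real). [cite: Balaban1984PropagatorsII, (2.1) p.224, dictionary] -/
theorem nKT_pos : (0 : ℝ) < ((nKT i : ℕ) : ℝ) := by exact_mod_cast lt_of_lt_of_le Nat.one_pos (one_le_nKT i)

open Classical in
/-- the Hölder seminorm on the torus in print's units: `‖f‖_α = sup_{x ≠ x′} |f(x′) − f(x)|/(η|x′ − x|_T)^α`, `η = L^{−k}`,
`|·|_T` the torus sup-distance. [cite: Balaban1984PropagatorsII, Prop. 2.2 (2.67) p.234 («‖ζ‖_α»); Balaban1984PropagatorsI, (1.109) p.35] -/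
def hqTP (α : ℝ) (f : ↥(i.XB) → ℝ) : ℝ :=
  ⨆ p : ↥(i.XB) × ↥(i.XB), if p.1 ≠ p.2 then |f p.2 - f p.1| / (torusSupNorm i.NB (p.2.1 - p.1.1) / (nKT i)) ^ α else 0

/-- `(∇^η_μG′λ)(x)` in print's units on the torus: `η·((G′λ)(x + e_μ) − (G′λ)(x))`, `x + e_μ` periodic.
[cite: Balaban1984PropagatorsII, Prop. 2.2 (2.67) p.234 (the entry ∇G′λ), (2.13) p.225, dictionary] -/
def dGT (μ : Fin (d + 1)) (f : ↥(i.XB) → ℝ) (x : ↥(i.XB)) : ℝ :=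
  (((nKT i : ℕ) : ℝ))⁻¹ * ((i.G *ᵥ f) (tshift i.NB (unitVec μ) x) - (i.G *ᵥ f) x)

/-- `(G′∇^{η*}_μλ)(x)` in print's units on the torus: `η·(G′∂_μᵀλ)(x)`, `∂_μ` periodic. [cite: Balaban1984PropagatorsII, Prop. 2.2 (2.67) p.234 (the entry G′∇*λ), dictionary] -/
def GdT (μ : Fin (d + 1)) (f : ↥(i.XB) → ℝ) (x : ↥(i.XB)) : ℝ :=
  (((nKT i : ℕ) : ℝ))⁻¹ * ((i.G * (dT i.NB μ)ᵀ) *ᵥ f) x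

open Classical in
/-- the Hölder entries (2.67)₄,₅ in print's units on the torus: `max_μ max(‖ζ∇^η_μG′λ‖_α, ‖ζG′∇^{η*}_μλ‖_α)`.
[cite: Balaban1984PropagatorsII, Prop. 2.2 (2.67) p.234] -/
def hHTP (f : ↥(i.XB) → ℝ) (α : ℝ) (ζ : ↥(i.XB) → ℝ) : ℝ :=
  ⨆ p : Fin (d + 1) × Bool, if p.2 then hqTP i α (fun x => ζ x * dGT i p.1 f x)
    else hqTP i α (fun x => ζ x * GdT i p.1 f x)

/-- **THE CENSUS GEOMETRY OF THE TORUS MEMBER IN PRINT'S UNITS**: file T8's `KTIdx.geoT` with `η := L^{−k}` (so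
`len y = L^jη = L^{j−k}`) and the Hölder vocabulary `‖·‖_α = hqTP`, `‖ζ‖_α + |ζ| = hqTP + supF`.
[cite: Balaban1984PropagatorsII, (2.1)–(2.2) p.224, (2.46) p.231, Prop. 2.2 (2.67) p.234] -/
def geoTP : Geometry :=
  { i.geoT with
    eta := (((nKT i : ℕ) : ℝ))⁻¹
    holder := hqTP i
    cutH := fun α ζ => hqTP i α ζ + i.supF ζ }

/-- **THE (2.67) FUNCTIONALS OF `G′` ON THE TORUS MEMBER IN PRINT'S UNITS**: the sup entries of `KTIdx.gp` rescaled by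
`η^{(2,1,1,0)}`, the Hölder slot `hHTP`. [cite: Balaban1984PropagatorsII, Prop. 2.2 (2.67) p.234] -/
def gpTP : GpFamily (geoTP i) where
  e := fun m f s => ((((nKT i : ℕ) : ℝ))⁻¹) ^ (epow m) * i.gp.e m f s
  h1 := hHTP i

/-- `(geoTP i).len y = L^j·η = L^j/L^k`. [cite: Balaban1984PropagatorsII, (2.1) p.224 («L^jη»), dictionary] -/
theorem geoTP_len (s : ↥(bset i.D.toDomains)) : (geoTP i).len s = ((ℓ : ℝ) + 1) ^ s.1.1 * (((nKT i : ℕ) : ℝ))⁻¹ := rfl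

/-- `0 < L^jη`. [cite: Balaban1984PropagatorsII, (2.1) p.224, dictionary] -/
theorem lenT_pos (s : ↥(bset i.D.toDomains)) : 0 < (geoTP i).len s := by
  rw [geoTP_len]; exact mul_pos (by positivity) (inv_pos.2 (nKT_pos i))

/-- `L^jη ≤ 1` — the blocks of every level are at most unit size in print's units (`j ≤ k`).
[cite: Balaban1984PropagatorsII, (2.1) p.224 («T^{(j)}_{L^jη}», j ≤ k), dictionary] -/
theorem lenT_le_one (s : ↥(bset i.D.toDomains)) : (geoTP i).len s ≤ 1 := by
  rw [geoTP_len]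
  have hn := nKT_pos i
  rw [mul_inv_le_iff₀ hn, one_mul]
  have hj : s.1.1 ≤ i.k := (scale_bounds i.D.toDomains s).2
  have : ((ℓ : ℝ) + 1) ^ s.1.1 ≤ ((ℓ : ℝ) + 1) ^ i.k :=
    pow_le_pow_right₀ (by have : (0 : ℝ) ≤ ℓ := Nat.cast_nonneg _; linarith) hj
  refine this.trans (le_of_eq ?_)
  simp [nKT]

/-- the sup entries of `gpTP` are the rescaled lattice entries. [cite: Balaban1984PropagatorsII, (2.67) p.234, dictionary] -/
theorem gpTP_e (m : Fin 4) (f : ↥(i.XB) → ℝ) (s : ↥(bset i.D.toDomains)) :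
    (gpTP i).e m f s = ((((nKT i : ℕ) : ℝ))⁻¹) ^ (epow m) * i.gp.e m f s := rfl

/-- the Hölder slot of `gpTP` is `hHTP`. [cite: Balaban1984PropagatorsII, (2.67) p.234, dictionary] -/
theorem gpTP_h1 : (gpTP i).h1 = hHTP i := rfl

/-- `0 ≤ |λ|`. [cite: Balaban1984PropagatorsII, Prop. 2.2 (2.67) p.234 («|λ|»), dictionary] -/
private theorem supF_nonneg (f : ↥(i.XB) → ℝ) : 0 ≤ i.supF f := by
  unfold KTIdx.supF
  exact le_ciSup_of_le (Set.finite_range _).bddAbove i.origin (abs_nonneg _)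

/-- `|λ(x)| ≤ |λ|`. [cite: Balaban1984PropagatorsII, Prop. 2.2 (2.67) p.234 («|λ|»), dictionary] -/
private theorem abs_le_supF (f : ↥(i.XB) → ℝ) (x : ↥(i.XB)) : |f x| ≤ i.supF f :=
  le_ciSup (Set.finite_range fun x : ↥(i.XB) => |f x|).bddAbove x

end Dictionary

/-! ## §2 The sup conjunct in print's units (rescaling of file T8's `prop22_supEntries_kLevelTorus`) -/

/-- **THE FIRST CONJUNCT OF `B6.Prop22Printed` ON THE GENUINE `k`-LEVEL TORUS FAMILY IN PRINT'S UNITS**: `∃ M₁ δ₀ C > 0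
∀ i, M₁ ≤ M → ∀ m λ y y′ (supp λ ⊂ B(y′)): e_m λ y ≤ C·[(L^jη)², L^jη, L^jη, 1]_m·e^{−½δ₀d_T(y,y′)}·|λ|` — file T8's
`prop22_supEntries_kLevelTorus` (lattice units) multiplied through by `η^{(2,1,1,0)_m}`; same constants.
[cite: Balaban1984PropagatorsII, Prop. 2.2 (2.67) p.234 (entries 1, 2, 3, 6); (2.46) p.231; p.224 (Ω₁ = T_η admitted)] -/
theorem prop22_supEntries_kLevelTorusP (d ℓ : ℕ) (hℓ : 1 ≤ ℓ) :
    ∃ M₁ δ₀ C : ℝ, 0 < M₁ ∧ 0 < δ₀ ∧ 0 < C ∧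
      ∀ i : KTIdx d ℓ, (geoTP i).Hyp21_22 → M₁ ≤ (geoTP i).M → ∀ (m : Fin 4)
        (lam : (geoTP i).Loc) (y y' : (geoTP i).Site), (geoTP i).suppIn lam y' →
          (gpTP i).e m lam y ≤ C * pref4 ((geoTP i).len y) m * Real.exp (-(δ₀ / 2 * (geoTP i).dist y y')) *
            (geoTP i).supNorm lam := by
  obtain ⟨M₁, δ₀, C, hM₁, hδ₀, hC, h⟩ := prop22_supEntries_kLevelTorus d ℓ hℓ
  refine ⟨M₁, δ₀, C, hM₁, hδ₀, hC, ?_⟩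
  intro i hH hM m lam y y' hsupp
  have h' := h i hH hM m lam y y' hsupp
  change ((((nKT i : ℕ) : ℝ))⁻¹) ^ (epow m) * i.gp.e m lam y
    ≤ C * pref4 (((ℓ : ℝ) + 1) ^ y.1.1 * (((nKT i : ℕ) : ℝ))⁻¹) m * Real.exp (-(δ₀ / 2 * i.geoT.dist y y')) * i.supF lam
  have hlen : i.geoT.len y = ((ℓ : ℝ) + 1) ^ y.1.1 := by rw [KTIdx.geoT_len, mul_one]
  rw [hlen] at h'
  rw [pref4_rescale]
  have hη : 0 ≤ ((((nKT i : ℕ) : ℝ))⁻¹) ^ (epow m) := pow_nonneg (inv_nonneg.2 (nKT_pos i).le) _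
  calc ((((nKT i : ℕ) : ℝ))⁻¹) ^ (epow m) * i.gp.e m lam y
      ≤ ((((nKT i : ℕ) : ℝ))⁻¹) ^ (epow m) * (C * pref4 (((ℓ : ℝ) + 1) ^ y.1.1) m
          * Real.exp (-(δ₀ / 2 * i.geoT.dist y y')) * i.supF lam) := mul_le_mul_of_nonneg_left h' hη
    _ = _ := by ring

/-! ## §3 Hölder plumbing in print's units, torus distance -/

section Plumbing

variable {ℓ : ℕ} (i : KTIdx d ℓ)

/-- distinct sites of the torus are at torus sup-distance `≥ 1`. [cite: Balaban1983RegularityDecay, p.572 («a torus T_η … with periodic conditions»), dictionary] -/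
theorem one_le_torusSupNorm_sub {x x' : ↥((B6Prop22KLevelTorusCensusL0.KTIdx.XB i))} (h : x'.1 ≠ x.1) :
    1 ≤ torusSupNorm i.NB (x'.1 - x.1) := by
  obtain ⟨j, hj⟩ : ∃ j, x'.1 j ≠ x.1 j := by
    by_contra hc
    push Not at hc
    exact h (funext hc)
  have hN : 1 ≤ i.NB j := one_le_N0 i.hMh i.hP j
  have hx := (mem_boxDom.1 x.2) j
  have hx' := (mem_boxDom.1 x'.2) j
  set v : ℤ := x'.1 j - x.1 j with hv
  have hv0 : v ≠ 0 := sub_ne_zero.2 hj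
  have hvN : v.natAbs < (i.NB j : ℤ).natAbs := by
    have h1 : |v| < (i.NB j : ℤ) := by rw [abs_lt]; constructor <;> omega
    have h2 : (v.natAbs : ℤ) < ((i.NB j : ℤ).natAbs : ℤ) := by
      rw [Int.natCast_natAbs, Int.natCast_natAbs, abs_of_nonneg (by positivity : (0 : ℤ) ≤ (i.NB j : ℤ))]
      exact h1
    exact_mod_cast h2
  have hr0 : v % (i.NB j : ℤ) ≠ 0 := fun h0 =>
    hv0 (Int.eq_zero_of_dvd_of_natAbs_lt_natAbs (Int.dvd_of_emod_eq_zero h0) hvN)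
  have hNpos : (0 : ℤ) < (i.NB j : ℤ) := by exact_mod_cast hN
  have hr1 := Int.emod_nonneg v hNpos.ne'
  have hr2 := Int.emod_lt_of_pos v hNpos
  have hc : 1 ≤ circAbs (i.NB j) v := by
    unfold circAbs
    refine le_min ?_ ?_ <;> omega
  have hcr : (1 : ℝ) ≤ ((circAbs (i.NB j) ((x'.1 - x.1) j) : ℤ) : ℝ) := by
    rw [Pi.sub_apply, ← hv]; exact_mod_cast hc
  exact hcr.trans (B6Prop22KLevelTorusCensus.KTIdx.circAbs_le_torusSupNorm i.NB (x'.1 - x.1) j)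

/-- `0 ≤ ‖f‖_α`. [cite: Balaban1984PropagatorsII, Prop. 2.2 (2.67) p.234 («‖ζ‖_α»), dictionary] -/
theorem hqTP_nonneg (α : ℝ) (f : ↥(i.XB) → ℝ) : 0 ≤ hqTP i α f := by
  classical
  unfold hqTP
  exact le_ciSup_of_le (Set.finite_range _).bddAbove (i.origin, i.origin) (by simp)

/-- one pair is bounded by the Hölder seminorm: `|f(x′) − f(x)|/(η|x′ − x|_T)^α ≤ ‖f‖_α`.
[cite: Balaban1984PropagatorsII, Prop. 2.2 (2.67) p.234 («‖ζ‖_α»), dictionary] -/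
theorem pair_le_hqTP (α : ℝ) (f : ↥(i.XB) → ℝ) (x x' : ↥(i.XB)) (hne : x ≠ x') :
    |f x' - f x| / (torusSupNorm i.NB (x'.1 - x.1) / (nKT i)) ^ α ≤ hqTP i α f := by
  classical
  unfold hqTP
  have h := le_ciSup (Set.finite_range fun p : ↥(i.XB) × ↥(i.XB) =>
    if p.1 ≠ p.2 then |f p.2 - f p.1| / (torusSupNorm i.NB (p.2.1 - p.1.1) / (nKT i)) ^ α else 0).bddAbove (x, x')
  simp only [ne_eq, hne, not_false_eq_true, if_true] at h
  exact h

/-- the pair quotient as a weighted value: `|v|/(|x′−x|_T/n)^α = (n/|x′−x|_T)^α·|v|` (`x′ ≠ x`).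
[cite: Balaban1984PropagatorsI, (1.109) p.35, dictionary] -/
theorem quot_eq_weightT (α : ℝ) (x x' : ↥(i.XB)) (hne : x'.1 ≠ x.1) (v : ℝ) :
    |v| / (torusSupNorm i.NB (x'.1 - x.1) / (nKT i)) ^ α
      = (((nKT i : ℕ) : ℝ)) ^ α * (torusSupNorm i.NB (x'.1 - x.1)) ^ (-α) * |v| := by
  have hs : 0 < torusSupNorm i.NB (x'.1 - x.1) := lt_of_lt_of_le one_pos (one_le_torusSupNorm_sub i hne)
  have hn : (0 : ℝ) < ((nKT i : ℕ) : ℝ) := nKT_pos i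
  rw [Real.div_rpow hs.le hn.le, Real.rpow_neg hs.le]
  have h1 : 0 < torusSupNorm i.NB (x'.1 - x.1) ^ α := Real.rpow_pos_of_pos hs α
  field_simp

/-- a bound of every pair quotient bounds the Hölder seminorm. [cite: Balaban1984PropagatorsII, Prop. 2.2 (2.67) p.234 («‖·‖_α»), dictionary] -/
theorem hqTP_le_of_forall (α : ℝ) (f : ↥(i.XB) → ℝ) {Bd : ℝ} (h0 : 0 ≤ Bd)
    (h : ∀ x x' : ↥(i.XB), x ≠ x' → |f x' - f x| / (torusSupNorm i.NB (x'.1 - x.1) / (nKT i)) ^ α ≤ Bd) :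
    hqTP i α f ≤ Bd := by
  classical
  unfold hqTP
  refine ciSup_le fun p => ?_
  split_ifs with hne
  · exact h p.1 p.2 hne
  · exact h0

/-- a common bound of the `2(d+1)` dressed seminorms bounds the Hölder slot. [cite: Balaban1984PropagatorsII, Prop. 2.2 (2.67) p.234, dictionary] -/
theorem hHTP_le_of_forall (f : ↥(i.XB) → ℝ) (α : ℝ) (ζ : ↥(i.XB) → ℝ) {Bd : ℝ}
    (hB : ∀ μ, hqTP i α (fun x => ζ x * dGT i μ f x) ≤ Bd)
    (hS : ∀ μ, hqTP i α (fun x => ζ x * GdT i μ f x) ≤ Bd) : hHTP i f α ζ ≤ Bd := by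
  classical
  unfold hHTP
  refine ciSup_le fun p => ?_
  rcases p with ⟨μ, b⟩
  cases b
  · simp only [Bool.false_eq_true, ↓reduceIte]; exact hS μ
  · simp only [↓reduceIte]; exact hB μ

/-- **THE PRODUCT RULE FOR ONE PAIR** of the `ζ`-dressed Hölder quotient (print's units, torus distance), `supp ζ ⊂ B(y)`:
if `|F| ≤ S` on `B(y)` (at the two sites) and `|F(x′) − F(x)|/(η|x′−x|_T)^α ≤ H` when both sites lie in `B(y)`, then
`|ζ(x′)F(x′) − ζ(x)F(x)|/(η|x′ − x|_T)^α ≤ ‖ζ‖_α·S + |ζ|·H`. [cite: Balaban1984PropagatorsII, Prop. 2.2 (2.67) p.234 («(‖ζ‖_α + |ζ|)»), dictionary] -/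
theorem holder_pair_boundTP (α : ℝ) (ζ F : ↥(i.XB) → ℝ) (y : ↥(bset i.D.toDomains))
    (hζ : ∀ w, ζ w ≠ 0 → blkOf i.D.toDomains w = y)
    (x x' : ↥(i.XB)) (hne : x ≠ x') {S H : ℝ} (hS0 : 0 ≤ S) (hH0 : 0 ≤ H)
    (hSx : blkOf i.D.toDomains x = y → |F x| ≤ S) (hSx' : blkOf i.D.toDomains x' = y → |F x'| ≤ S)
    (hH : blkOf i.D.toDomains x = y → blkOf i.D.toDomains x' = y →
      |F x' - F x| / (torusSupNorm i.NB (x'.1 - x.1) / (nKT i)) ^ α ≤ H) :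
    |ζ x' * F x' - ζ x * F x| / (torusSupNorm i.NB (x'.1 - x.1) / (nKT i)) ^ α ≤ hqTP i α ζ * S + i.supF ζ * H := by
  have hq0 := hqTP_nonneg i α ζ
  have hz0 := supF_nonneg i ζ
  have hr : 0 < (torusSupNorm i.NB (x'.1 - x.1) / (nKT i)) ^ α := by
    have hne' : x'.1 ≠ x.1 := fun h => hne (Subtype.ext h).symm
    have hs : 0 < torusSupNorm i.NB (x'.1 - x.1) := lt_of_lt_of_le one_pos (one_le_torusSupNorm_sub i hne')
    exact Real.rpow_pos_of_pos (div_pos hs (nKT_pos i)) α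
  have hpair : |ζ x' - ζ x| / (torusSupNorm i.NB (x'.1 - x.1) / (nKT i)) ^ α ≤ hqTP i α ζ :=
    pair_le_hqTP i α ζ x x' hne
  by_cases hx : blkOf i.D.toDomains x = y
  · by_cases hx' : blkOf i.D.toDomains x' = y
    · have e : ζ x' * F x' - ζ x * F x = ζ x' * (F x' - F x) + (ζ x' - ζ x) * F x := by ring
      rw [e]
      calc |ζ x' * (F x' - F x) + (ζ x' - ζ x) * F x| / (torusSupNorm i.NB (x'.1 - x.1) / (nKT i)) ^ α
          ≤ (|ζ x'| * |F x' - F x| + |ζ x' - ζ x| * |F x|) / (torusSupNorm i.NB (x'.1 - x.1) / (nKT i)) ^ α := by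
            refine div_le_div_of_nonneg_right ?_ hr.le
            calc _ ≤ |ζ x' * (F x' - F x)| + |(ζ x' - ζ x) * F x| := abs_add_le _ _
              _ = _ := by rw [abs_mul, abs_mul]
        _ = |ζ x'| * (|F x' - F x| / (torusSupNorm i.NB (x'.1 - x.1) / (nKT i)) ^ α)
            + |ζ x' - ζ x| / (torusSupNorm i.NB (x'.1 - x.1) / (nKT i)) ^ α * |F x| := by ring
        _ ≤ i.supF ζ * H + hqTP i α ζ * S := by
            refine add_le_add ?_ ?_
            · exact mul_le_mul (abs_le_supF i ζ x') (hH hx hx') (by positivity) hz0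
            · exact mul_le_mul hpair (hSx hx) (abs_nonneg _) hq0
        _ = hqTP i α ζ * S + i.supF ζ * H := by ring
    · have hz' : ζ x' = 0 := by by_contra h; exact hx' (hζ x' h)
      rw [hz', zero_mul, zero_sub, abs_neg, abs_mul]
      calc |ζ x| * |F x| / (torusSupNorm i.NB (x'.1 - x.1) / (nKT i)) ^ α
          = |ζ x' - ζ x| / (torusSupNorm i.NB (x'.1 - x.1) / (nKT i)) ^ α * |F x| := by
            rw [hz', zero_sub, abs_neg]; ring
        _ ≤ hqTP i α ζ * S := mul_le_mul hpair (hSx hx) (abs_nonneg _) hq0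
        _ ≤ hqTP i α ζ * S + i.supF ζ * H := le_add_of_nonneg_right (by positivity)
  · have hz : ζ x = 0 := by by_contra h; exact hx (hζ x h)
    by_cases hx' : blkOf i.D.toDomains x' = y
    · rw [hz, zero_mul, sub_zero, abs_mul]
      calc |ζ x'| * |F x'| / (torusSupNorm i.NB (x'.1 - x.1) / (nKT i)) ^ α
          = |ζ x' - ζ x| / (torusSupNorm i.NB (x'.1 - x.1) / (nKT i)) ^ α * |F x'| := by rw [hz, sub_zero]; ring
        _ ≤ hqTP i α ζ * S := mul_le_mul hpair (hSx' hx') (abs_nonneg _) hq0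
        _ ≤ hqTP i α ζ * S + i.supF ζ * H := le_add_of_nonneg_right (by positivity)
    · have hz' : ζ x' = 0 := by by_contra h; exact hx' (hζ x' h)
      rw [hz, hz', zero_mul, zero_mul, sub_zero, abs_zero, zero_div]
      positivity

end Plumbing

/-! ## §4 The Hölder conjunct on the genuine `k`-level torus family, in print's units: one threshold and one rate for all `α` -/

/-- **PROPOSITION 2.2 (2.67), THE HÖLDER ENTRIES 4 AND 5, IN THE CENSUS TYPING ON THE GENUINE `k`-LEVEL TORUS FAMILY
(PRINT'S UNITS), ONE THRESHOLD AND ONE RATE FOR ALL `α`** — the second conjunct of `B6.Prop22Printed (geoTP) (gpTP)` in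
its printed quantifier order: there are `M₁, δ₀ > 0` (depending on `d`, `L`) and for every `0 ≤ α < 1` a `C_α > 0` such
that for EVERY nested family (2.1)–(2.2) of the torus with `M = L·M_h ≥ M₁`, every `λ` with `supp λ ⊂ B(y′)`, every
cut-off `ζ` with `supp ζ ⊂ B(y)`:
`max_μ max(‖ζ∇^η_μG′λ‖_α, ‖ζG′∇^{η*}_μλ‖_α) ≤ C·(L^jη)^{1−α}·(‖ζ‖_α + |ζ|)·e^{−½δ₀d_T(y,y′)}·|λ|`.  From files T6/T7
(entries 2, 3: `sup_{B(y)}|∇G′λ|, |G′∇*λ| = O(L^j)` lattice, `= O(L^jη)` print) and T9/T10 (entries 4, 5 on the pairs of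
one block: `O((L^j)^{1−α})` lattice, `O((L^jη)^{1−α})` print, with their `α`-UNIFORM rates `…_unif`) by the product rule
`holder_pair_boundTP`, with `L^jη ≤ (L^jη)^{1−α}` (`L^jη ≤ 1`, `lenT_le_one`) on the `‖ζ‖_α` term, exactly as in print.
[cite: Balaban1984PropagatorsII, Prop. 2.2 (2.67) p.234 (entries 4, 5); (2.46) p.231; p.224 (Ω₁ = T_η admitted); Balaban1983RegularityDecay, Thm (1.9) p.573] -/
theorem prop22_holderEntries_kLevelTorusP_unif (d ℓ : ℕ) (hℓ : 1 ≤ ℓ) :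
    ∃ M₁ δ₀ : ℝ, 0 < M₁ ∧ 0 < δ₀ ∧ ∀ (α : ℝ), 0 ≤ α → α < 1 → ∃ C : ℝ, 0 < C ∧
      ∀ i : KTIdx d ℓ, (geoTP i).Hyp21_22 → M₁ ≤ (geoTP i).M →
        ∀ (lam : (geoTP i).Loc) (ζ : (geoTP i).Cut) (y y' : (geoTP i).Site), (geoTP i).cutIn ζ y →
          (geoTP i).suppIn lam y' →
          (gpTP i).h1 lam α ζ ≤ C * ((geoTP i).len y) ^ (1 - α) * (geoTP i).cutH α ζ *
            Real.exp (-(δ₀ / 2 * (geoTP i).dist y y')) * (geoTP i).supNorm lam := by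
  classical
  -- the windows of the printed weights
  set amin : ℝ := 1 - ((((ℓ : ℝ) + 1)) ^ 2)⁻¹ with hamin_def
  have hL2 : (1 : ℝ) < (((ℓ : ℝ) + 1)) ^ 2 := by
    have : (2 : ℝ) ≤ (ℓ : ℝ) + 1 := by
      have : (1 : ℝ) ≤ ℓ := by exact_mod_cast hℓ
      linarith
    nlinarith
  have hamin : 0 < amin := by
    rw [hamin_def, sub_pos]
    exact inv_lt_one_of_one_lt₀ hL2
  obtain ⟨hwin, hrec⟩ := KIdx.aPrinted_windows hℓ
  -- the four packages at this `α`: entries 2, 3 as majorants on `T_η`, entries 4, 5 on the pairs of one block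
  obtain ⟨δ₂, C₂, M₂, N₂, hδ₂, hC₂, hM₂, hN₂, hA2⟩ := prop22_second_multiLevelTorus d ℓ hℓ amin 1 1 1 hamin one_pos
  obtain ⟨δ₃, C₃, M₃, N₃, hδ₃, hC₃, hM₃, hN₃, hA3⟩ := prop22_third_multiLevelTorus d ℓ hℓ amin 1 1 1 hamin one_pos
  obtain ⟨δ₄, M₄, N₄, hδ₄, hM₄, hN₄, hA4u⟩ :=
    prop22_fourth_multiLevelTorus_unif d ℓ hℓ amin 1 1 1 hamin one_pos
  obtain ⟨δ₅, M₅, N₅, hδ₅, hM₅, hN₅, hA5u⟩ :=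
    prop22_fifth_multiLevelTorus_unif d ℓ hℓ amin 1 1 1 hamin one_pos
  set δ₀ : ℝ := min (min δ₂ δ₃) (min δ₄ δ₅) with hδ₀_def
  have hδ₀ : 0 < δ₀ := lt_min (lt_min hδ₂ hδ₃) (lt_min hδ₄ hδ₅)
  set Nm : ℕ := max (max N₂ N₃) (max N₄ N₅) with hNm
  set M₁ : ℝ := max (max (max (max M₂ M₃) (max M₄ M₅)) ((Nm : ℝ) + 1)) (3 * ((ℓ : ℝ) + 1)) with hM₁_def
  refine ⟨M₁, δ₀, lt_of_lt_of_le hM₂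
    (le_trans (le_trans (le_trans (le_max_left _ _) (le_max_left _ _)) (le_max_left _ _)) (le_max_left _ _)),
    hδ₀, fun α hα0 hα1 => ?_⟩
  obtain ⟨C₄, hC₄, hA4⟩ := hA4u α hα0 hα1
  obtain ⟨C₅, hC₅, hA5⟩ := hA5u α hα0 hα1
  set CC : ℝ := C₂ + C₃ + C₄ + C₅ with hCC_def
  have hCC : 0 < CC := by positivity
  refine ⟨CC, hCC, ?_⟩
  intro i _ hM lam ζ y y' hcut hsupp
  change ↥(i.XB) → ℝ at lam
  change ↥(i.XB) → ℝ at ζ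
  change ↥(bset i.D.toDomains) at y
  change ↥(bset i.D.toDomains) at y'
  change M₁ ≤ ((ℓ : ℝ) + 1) * i.Mh at hM
  change ∀ w, ζ w ≠ 0 → blkOf i.D.toDomains w = y at hcut
  change ∀ x, lam x ≠ 0 → blkOf i.D.toDomains x = y' at hsupp
  -- «M sufficiently large» for the four packages
  have hMa : max (max M₂ M₃) (max M₄ M₅) ≤ ((ℓ : ℝ) + 1) * i.Mh :=
    le_trans (le_trans (le_max_left _ _) (le_max_left _ _)) hM
  have hM2' : M₂ ≤ ((ℓ : ℝ) + 1) * i.Mh := le_trans (le_trans (le_max_left _ _) (le_max_left _ _)) hMa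
  have hM3' : M₃ ≤ ((ℓ : ℝ) + 1) * i.Mh := le_trans (le_trans (le_max_right _ _) (le_max_left _ _)) hMa
  have hM4' : M₄ ≤ ((ℓ : ℝ) + 1) * i.Mh := le_trans (le_trans (le_max_left _ _) (le_max_right _ _)) hMa
  have hM5' : M₅ ≤ ((ℓ : ℝ) + 1) * i.Mh := le_trans (le_trans (le_max_right _ _) (le_max_right _ _)) hMa
  have hLpos : (0 : ℝ) < (ℓ : ℝ) + 1 := by positivity
  have hMh3 : 3 ≤ i.Mh := by
    have h3 : 3 * ((ℓ : ℝ) + 1) ≤ ((ℓ : ℝ) + 1) * i.Mh := le_trans (le_max_right _ _) hM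
    have : (3 : ℝ) ≤ i.Mh := by nlinarith
    exact_mod_cast this
  have hMh1 : 1 ≤ i.Mh := le_trans (by norm_num) hMh3
  have hRM : ∀ N : ℕ, N ≤ Nm → N + 1 ≤ i.R * ((ℓ + 1) * i.Mh) := by
    intro N hN
    have h1 : ((Nm : ℝ) + 1) ≤ ((ℓ : ℝ) + 1) * i.Mh :=
      le_trans (le_trans (le_max_right _ _) (le_max_left _ _)) hM
    have h2 : Nm + 1 ≤ (ℓ + 1) * i.Mh := by exact_mod_cast h1
    have hR1 : 1 ≤ i.R := le_trans (by omega) i.hR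
    calc N + 1 ≤ 1 * ((ℓ + 1) * i.Mh) := by rw [one_mul]; omega
      _ ≤ i.R * ((ℓ + 1) * i.Mh) := Nat.mul_le_mul_right _ hR1
  have hN2m : N₂ ≤ Nm := le_trans (le_max_left _ _) (le_max_left _ _)
  have hN3m : N₃ ≤ Nm := le_trans (le_max_right _ _) (le_max_left _ _)
  have hN4m : N₄ ≤ Nm := le_trans (le_max_left _ _) (le_max_right _ _)
  have hN5m : N₅ ≤ Nm := le_trans (le_max_right _ _) (le_max_right _ _)
  have h2 := hA2 i.k i.Mh i.R hMh3 hM2' i.hR (hRM N₂ hN2m) i.P i.hP i.hP4 i.D (fun j => aPrinted ℓ 1 (j + 1)) (fun _ => 1) hwin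
    (fun _ => ⟨le_rfl, le_rfl⟩) hrec
  have h3 := hA3 i.k i.Mh i.R hMh3 hM3' i.hR (hRM N₃ hN3m) i.P i.hP i.hP4 i.D (fun j => aPrinted ℓ 1 (j + 1)) (fun _ => 1) hwin
    (fun _ => ⟨le_rfl, le_rfl⟩) hrec
  have h4 := hA4 i.k i.Mh i.R hMh3 hM4' i.hR (hRM N₄ hN4m) i.P i.hP i.hP4 i.D (fun j => aPrinted ℓ 1 (j + 1)) (fun _ => 1) hwin
    (fun _ => ⟨le_rfl, le_rfl⟩) hrec
  have h5 := hA5 i.k i.Mh i.R hMh3 hM5' i.hR (hRM N₅ hN5m) i.P i.hP i.hP4 i.D (fun j => aPrinted ℓ 1 (j + 1)) (fun _ => 1) hwin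
    (fun _ => ⟨le_rfl, le_rfl⟩) hrec
  have hBS := i.blockSupp_of_suppIn lam y' hsupp
  -- the common shape of the target
  set n : ℝ := ((nKT i : ℕ) : ℝ) with hn_def
  have hn : 0 < n := nKT_pos i
  set t : ℝ := (geoTP i).len y with ht_def
  have ht : t = ((ℓ : ℝ) + 1) ^ y.1.1 * n⁻¹ := geoTP_len i y
  have ht0 : 0 < t := lenT_pos i y
  have ht1 : t ≤ 1 := lenT_le_one i y
  have hLj0 : (0 : ℝ) ≤ ((ℓ : ℝ) + 1) ^ y.1.1 := by positivity
  set E : ℝ := Real.exp (-(δ₀ / 2 * (geoTP i).dist y y')) with hE_def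
  have hdist0 : 0 ≤ (geomT i.D).dist y y' := by
    change (0 : ℝ) ≤ (((bondT i.D).dist y y' : ℕ) : ℝ); exact Nat.cast_nonneg _
  have hEmono : ∀ δ : ℝ, δ₀ ≤ δ → Real.exp (-(δ / 2 * (geomT i.D).dist y y')) ≤ E := by
    intro δ hδ
    rw [hE_def]; apply Real.exp_le_exp.2
    change -(δ / 2 * (geomT i.D).dist y y') ≤ -(δ₀ / 2 * (geomT i.D).dist y y')
    have := mul_le_mul_of_nonneg_right (div_le_div_of_nonneg_right hδ (by norm_num : (0 : ℝ) ≤ 2)) hdist0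
    linarith
  have hE2 := hEmono δ₂ (le_trans (min_le_left _ _) (min_le_left _ _))
  have hE3 := hEmono δ₃ (le_trans (min_le_left _ _) (min_le_right _ _))
  have hE4 := hEmono δ₄ (le_trans (min_le_right _ _) (min_le_left _ _))
  have hE5 := hEmono δ₅ (le_trans (min_le_right _ _) (min_le_right _ _))
  have hS0 := supF_nonneg i lam
  change hHTP i lam α ζ ≤ CC * t ^ (1 - α) * (hqTP i α ζ + i.supF ζ) * E * i.supF lam
  -- the common per-pair bound `B = CC·t^{1−α}·E·|λ|`
  set B : ℝ := CC * t ^ (1 - α) * E * i.supF lam with hB_def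
  have htα : 0 ≤ t ^ (1 - α) := Real.rpow_nonneg ht0.le _
  have hE0 : 0 ≤ E := (Real.exp_pos _).le
  have hB0 : 0 ≤ B := by positivity
  have ht_le : t ≤ t ^ (1 - α) := by
    have h := Real.rpow_le_rpow_of_exponent_ge ht0 ht1 (by linarith : 1 - α ≤ 1)
    rwa [Real.rpow_one] at h
  have hC2_le : C₂ ≤ CC := by rw [hCC_def]; linarith
  have hC3_le : C₃ ≤ CC := by rw [hCC_def]; linarith
  have hC4_le : C₄ ≤ CC := by rw [hCC_def]; linarith
  have hC5_le : C₅ ≤ CC := by rw [hCC_def]; linarith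
  -- sup bounds (entries 2, 3): `|η·F(x)| ≤ C·L^jη·E·|λ| ≤ B` on `B(y)`
  have sup_to_B : ∀ (Cs δs v : ℝ), 0 ≤ Cs → Cs ≤ CC → Real.exp (-(δs / 2 * (geomT i.D).dist y y')) ≤ E →
      |v| ≤ Cs * ((ℓ : ℝ) + 1) ^ y.1.1 * Real.exp (-(δs / 2 * (geomT i.D).dist y y')) * i.supF lam →
      |n⁻¹ * v| ≤ B := by
    intro Cs δs v hCs0 hCs hEs hv
    rw [abs_mul, abs_of_pos (inv_pos.2 hn)]
    calc n⁻¹ * |v| ≤ n⁻¹ * (Cs * ((ℓ : ℝ) + 1) ^ y.1.1 * Real.exp (-(δs / 2 * (geomT i.D).dist y y')) * i.supF lam) :=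
          mul_le_mul_of_nonneg_left hv (inv_nonneg.2 hn.le)
      _ = Cs * t * Real.exp (-(δs / 2 * (geomT i.D).dist y y')) * i.supF lam := by rw [ht]; ring
      _ ≤ CC * t ^ (1 - α) * E * i.supF lam := by
          have h1 : Cs * t ≤ CC * t ^ (1 - α) := mul_le_mul hCs ht_le ht0.le hCC.le
          exact mul_le_mul (mul_le_mul h1 hEs (Real.exp_pos _).le (by positivity)) le_rfl hS0 (by positivity)
  -- pair bounds (entries 4, 5): `n^α·s^{−α}|F(x′)−F(x)|·η ≤ C·(L^jη)^{1−α}·E·|λ| ≤ B` on the pairs of `B(y)`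
  have pair_to_B : ∀ (Cs δs s v : ℝ), Cs ≤ CC → Real.exp (-(δs / 2 * (geomT i.D).dist y y')) ≤ E →
      s ^ (-α) * |v| ≤ Cs * (((ℓ : ℝ) + 1) ^ y.1.1) ^ (1 - α)
        * Real.exp (-(δs / 2 * (geomT i.D).dist y y')) * i.supF lam →
      n ^ α * s ^ (-α) * |n⁻¹ * v| ≤ B := by
    intro Cs δs s v hCs hEs hv
    rw [abs_mul, abs_of_pos (inv_pos.2 hn)]
    have hnα : 0 ≤ n ^ α := Real.rpow_nonneg hn.le _
    calc n ^ α * s ^ (-α) * (n⁻¹ * |v|) = n⁻¹ * n ^ α * (s ^ (-α) * |v|) := by ring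
      _ ≤ n⁻¹ * n ^ α * (Cs * (((ℓ : ℝ) + 1) ^ y.1.1) ^ (1 - α)
          * Real.exp (-(δs / 2 * (geomT i.D).dist y y')) * i.supF lam) :=
          mul_le_mul_of_nonneg_left hv (by positivity)
      _ = Cs * (n⁻¹ * n ^ α * (((ℓ : ℝ) + 1) ^ y.1.1) ^ (1 - α))
          * Real.exp (-(δs / 2 * (geomT i.D).dist y y')) * i.supF lam := by ring
      _ = Cs * t ^ (1 - α) * Real.exp (-(δs / 2 * (geomT i.D).dist y y')) * i.supF lam := by
          rw [eta_weight hn hLj0 α, ← ht]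
      _ ≤ CC * t ^ (1 - α) * E * i.supF lam := by
          have hX : 0 ≤ t ^ (1 - α) * Real.exp (-(δs / 2 * (geomT i.D).dist y y')) * i.supF lam := by positivity
          have h0 : Cs * (t ^ (1 - α) * Real.exp (-(δs / 2 * (geomT i.D).dist y y')) * i.supF lam)
              ≤ CC * (t ^ (1 - α) * Real.exp (-(δs / 2 * (geomT i.D).dist y y')) * i.supF lam) :=
            mul_le_mul_of_nonneg_right hCs hX
          have h1 : CC * (t ^ (1 - α) * Real.exp (-(δs / 2 * (geomT i.D).dist y y')) * i.supF lam)
              ≤ CC * (t ^ (1 - α) * E * i.supF lam) :=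
            mul_le_mul_of_nonneg_left (mul_le_mul_of_nonneg_right (mul_le_mul_of_nonneg_left hEs htα) hS0) hCC.le
          calc Cs * t ^ (1 - α) * Real.exp (-(δs / 2 * (geomT i.D).dist y y')) * i.supF lam
              = Cs * (t ^ (1 - α) * Real.exp (-(δs / 2 * (geomT i.D).dist y y')) * i.supF lam) := by ring
            _ ≤ CC * (t ^ (1 - α) * E * i.supF lam) := h0.trans h1
            _ = CC * t ^ (1 - α) * E * i.supF lam := by ring
  have hbound : hqTP i α ζ * B + i.supF ζ * B = CC * t ^ (1 - α) * (hqTP i α ζ + i.supF ζ) * E * i.supF lam := by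
    rw [hB_def]; ring
  rw [← hbound]
  have hBB : 0 ≤ hqTP i α ζ * B + i.supF ζ * B := by
    have := hqTP_nonneg i α ζ; have := supF_nonneg i ζ; positivity
  refine hHTP_le_of_forall i lam α ζ (fun μ => ?_) (fun μ => ?_)
  · -- entry 4: `ζ·∇^η_μG′λ`, pairs (periodic bond function)
    refine hqTP_le_of_forall i α _ hBB fun x x' hne => ?_
    have hne' : x'.1 ≠ x.1 := fun h => hne (Subtype.ext h).symm
    refine holder_pair_boundTP i α ζ (dGT i μ lam) y hcut x x' hne hB0 hB0 ?_ ?_ ?_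
    · intro hx
      have h := h2 μ y' lam (i.supF lam) hBS x
      rw [Matrix.toLin'_apply, hx] at h
      simp only at h
      show |dGT i μ lam x| ≤ B
      unfold dGT
      rw [← i.dT_G_mulVec]
      exact sup_to_B C₂ δ₂ _ hC₂.le hC2_le hE2 h
    · intro hx'
      have h := h2 μ y' lam (i.supF lam) hBS x'
      rw [Matrix.toLin'_apply, hx'] at h
      simp only at h
      show |dGT i μ lam x'| ≤ B
      unfold dGT
      rw [← i.dT_G_mulVec]
      exact sup_to_B C₂ δ₂ _ hC₂.le hC2_le hE2 h
    · intro hx hx'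
      have hblk : blkOf i.D.toDomains x' = blkOf i.D.toDomains x := by rw [hx, hx']
      have h4' := h4 μ y' lam (i.supF lam) hBS x x' hne' hblk
      rw [← B6MultiLevelTorusOperatorL0.TDomains.toDomains_lev, lev_eq_of_blkOf_eq (D := i.D.toDomains) hx, hx] at h4'
      show |dGT i μ lam x' - dGT i μ lam x| / (torusSupNorm i.NB (x'.1 - x.1) / (nKT i)) ^ α ≤ B
      rw [quot_eq_weightT i α x x' hne']
      unfold dGT
      rw [← mul_sub]
      exact pair_to_B C₄ δ₄ _ _ hC4_le hE4 h4'
  · -- entry 5: `ζ·G′∇^{η*}_μλ`, pairs (site function)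
    refine hqTP_le_of_forall i α _ hBB fun x x' hne => ?_
    have hne' : x'.1 ≠ x.1 := fun h => hne (Subtype.ext h).symm
    refine holder_pair_boundTP i α ζ (GdT i μ lam) y hcut x x' hne hB0 hB0 ?_ ?_ ?_
    · intro hx
      have h := h3 μ y' lam (i.supF lam) hBS x
      rw [Matrix.toLin'_apply, hx] at h
      simp only at h
      show |GdT i μ lam x| ≤ B
      unfold GdT
      exact sup_to_B C₃ δ₃ _ hC₃.le hC3_le hE3 h
    · intro hx'
      have h := h3 μ y' lam (i.supF lam) hBS x'
      rw [Matrix.toLin'_apply, hx'] at h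
      simp only at h
      show |GdT i μ lam x'| ≤ B
      unfold GdT
      exact sup_to_B C₃ δ₃ _ hC₃.le hC3_le hE3 h
    · intro hx hx'
      have hblk : blkOf i.D.toDomains x' = blkOf i.D.toDomains x := by rw [hx, hx']
      have h5' := h5 μ y' lam (i.supF lam) hBS x x' hne' hblk
      rw [← B6MultiLevelTorusOperatorL0.TDomains.toDomains_lev, lev_eq_of_blkOf_eq (D := i.D.toDomains) hx, hx] at h5'
      show |GdT i μ lam x' - GdT i μ lam x| / (torusSupNorm i.NB (x'.1 - x.1) / (nKT i)) ^ α ≤ B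
      rw [quot_eq_weightT i α x x' hne']
      unfold GdT
      rw [← mul_sub]
      exact pair_to_B C₅ δ₅ _ _ hC5_le hE5 h5'

/-- the Hölder conjunct at a fixed `α` (the per-`α` form, corollary of the `α`-uniform one). [cite: Balaban1984PropagatorsII, Prop. 2.2 (2.67) p.234 (entries 4, 5); (2.46) p.231] -/
theorem prop22_holderEntries_kLevelTorusP (d ℓ : ℕ) (hℓ : 1 ≤ ℓ) (α : ℝ) (hα0 : 0 ≤ α) (hα1 : α < 1) :
    ∃ M₁ δ₀ C : ℝ, 0 < M₁ ∧ 0 < δ₀ ∧ 0 < C ∧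
      ∀ i : KTIdx d ℓ, (geoTP i).Hyp21_22 → M₁ ≤ (geoTP i).M →
        ∀ (lam : (geoTP i).Loc) (ζ : (geoTP i).Cut) (y y' : (geoTP i).Site), (geoTP i).cutIn ζ y →
          (geoTP i).suppIn lam y' →
          (gpTP i).h1 lam α ζ ≤ C * ((geoTP i).len y) ^ (1 - α) * (geoTP i).cutH α ζ *
            Real.exp (-(δ₀ / 2 * (geoTP i).dist y y')) * (geoTP i).supNorm lam := by
  obtain ⟨M₁, δ₀, hM₁, hδ₀, h⟩ := prop22_holderEntries_kLevelTorusP_unif d ℓ hℓ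
  obtain ⟨C, hC, h'⟩ := h α hα0 hα1
  exact ⟨M₁, δ₀, C, hM₁, hδ₀, hC, h'⟩

/-! ## §5 Both conjuncts of the census sentence: at each `α`, and VERBATIM (`B6.Prop22Printed`); non-vacuity -/

/-- **PROPOSITION 2.2 IN ITS CENSUS TYPING, AT EACH HÖLDER EXPONENT, ON THE GENUINE `k`-LEVEL TORUS FAMILY IN PRINT'S
UNITS** — the body of `B6.Prop22Printed (fun i : KTIdx d ℓ => geoTP i) (fun i => gpTP i)` with the quantifier `∀ α`
moved OUTSIDE (`∀ α ∈ [0,1) ∃ M₁ δ₀ C C_α`): ONE threshold and ONE rate for the four sup entries and the two Hölder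
entries at this `α`, the printed prefactors `[(L^jη)², L^jη, L^jη, (L^jη)^{1−α}(‖ζ‖_α + |ζ|), (L^jη)^{1−α}(‖ζ‖_α +
|ζ|), 1]`, the realised torus distance (2.46), for EVERY nested family (2.1)–(2.2) of the torus `T_η`, every number of
levels.  (`§2` + `§4`, rates by `min`, thresholds by `max`.) [cite: Balaban1984PropagatorsII, Prop. 2.2 (2.67) p.234; (2.1)–(2.2) p.224 (Ω₁ = T_η admitted); (2.46) p.231] -/
theorem prop22Printed_kLevelTorusP_perAlpha (d ℓ : ℕ) (hℓ : 1 ≤ ℓ) (α : ℝ) (hα0 : 0 ≤ α) (hα1 : α < 1) :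
    ∃ M₁ δ₀ C Cα : ℝ, 0 < M₁ ∧ 0 < δ₀ ∧ 0 < C ∧
      ∀ i : KTIdx d ℓ, (geoTP i).Hyp21_22 → M₁ ≤ (geoTP i).M →
        (∀ (m : Fin 4) (lam : (geoTP i).Loc) (y y' : (geoTP i).Site), (geoTP i).suppIn lam y' →
            (gpTP i).e m lam y ≤ C * pref4 ((geoTP i).len y) m * Real.exp (-(δ₀ / 2 * (geoTP i).dist y y')) *
              (geoTP i).supNorm lam) ∧
        (∀ (lam : (geoTP i).Loc) (ζ : (geoTP i).Cut) (y y' : (geoTP i).Site),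
            (geoTP i).cutIn ζ y → (geoTP i).suppIn lam y' →
            (gpTP i).h1 lam α ζ ≤ Cα * ((geoTP i).len y) ^ (1 - α) * (geoTP i).cutH α ζ *
              Real.exp (-(δ₀ / 2 * (geoTP i).dist y y')) * (geoTP i).supNorm lam) := by
  obtain ⟨M₁, δ₁, C, hM₁, hδ₁, hC, hS⟩ := prop22_supEntries_kLevelTorusP d ℓ hℓ
  obtain ⟨M₂, δ₂, Cα, hM₂, hδ₂, hCα, hH⟩ := prop22_holderEntries_kLevelTorusP d ℓ hℓ α hα0 hα1
  refine ⟨max M₁ M₂, min δ₁ δ₂, C, Cα, lt_max_of_lt_left hM₁, lt_min hδ₁ hδ₂, hC, ?_⟩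
  intro i hHyp hM
  have hdist0 : ∀ y y' : (geoTP i).Site, 0 ≤ (geoTP i).dist y y' := by
    intro y y'
    change (0 : ℝ) ≤ (((bondT i.D).dist y y' : ℕ) : ℝ); exact Nat.cast_nonneg _
  have hEmono : ∀ (δ : ℝ) (y y' : (geoTP i).Site), min δ₁ δ₂ ≤ δ →
      Real.exp (-(δ / 2 * (geoTP i).dist y y')) ≤ Real.exp (-(min δ₁ δ₂ / 2 * (geoTP i).dist y y')) := by
    intro δ y y' hδ
    apply Real.exp_le_exp.2
    have := mul_le_mul_of_nonneg_right (div_le_div_of_nonneg_right hδ (by norm_num : (0 : ℝ) ≤ 2)) (hdist0 y y')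
    linarith
  have hsup0 : ∀ lam : (geoTP i).Loc, 0 ≤ (geoTP i).supNorm lam := fun lam => supF_nonneg i lam
  refine ⟨fun m lam y y' hsupp => ?_, fun lam ζ y y' hcut hsupp => ?_⟩
  · have h := hS i hHyp ((le_max_left _ _).trans hM) m lam y y' hsupp
    refine h.trans ?_
    have hp : 0 ≤ pref4 ((geoTP i).len y) m := by
      have := (lenT_pos i y).le
      fin_cases m <;> simp [pref4] <;> positivity
    exact mul_le_mul_of_nonneg_right (mul_le_mul_of_nonneg_left (hEmono δ₁ y y' (min_le_left _ _)) (by positivity))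
      (hsup0 lam)
  · have h := hH i hHyp ((le_max_right _ _).trans hM) lam ζ y y' hcut hsupp
    refine h.trans ?_
    have hcut0 : 0 ≤ (geoTP i).cutH α ζ := by
      change 0 ≤ hqTP i α ζ + i.supF ζ
      have := hqTP_nonneg i α ζ; have := supF_nonneg i ζ; positivity
    have hl : 0 ≤ ((geoTP i).len y) ^ (1 - α) := Real.rpow_nonneg (lenT_pos i y).le _
    exact mul_le_mul_of_nonneg_right (mul_le_mul_of_nonneg_left (hEmono δ₂ y y' (min_le_right _ _)) (by positivity))
      (hsup0 lam)

/-- **[B6] PROPOSITION 2.2 IN ITS CENSUS TYPING — `B6.Prop22Printed` VERBATIM — FOR THE GENUINE `k`-LEVEL OPERATOR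
`G′ = Δ′_a^{−1}` ON EVERY NESTED FAMILY (2.1)–(2.2) OF THE TORUS `T_η` (PRINT'S CARRIER, `Ω₁ = T_η`), IN PRINT'S UNITS
`η = L^{−k}`**: `∃ M₁ δ₀ C, ∃ Cα : ℝ → ℝ` such that for every member `i : KTIdx d ℓ` with `M₁ ≤ M`: the four sup entries
`|(G′λ)(x)|, |(∇^η_xG′λ)(x)|, |(G′∇^{η*}λ)(x)|, |(Δ^ηG′λ)(x)| ≤ C·[(L^jη)², L^jη, L^jη, 1]·e^{−½δ₀d_T(y,y′)}|λ|` (§2) AND,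
for every `0 ≤ α < 1`, the Hölder entries `‖ζ∇^η_xG′λ‖_α, ‖ζG′∇^{η*}λ‖_α ≤ Cα(α)·(L^jη)^{1−α}(‖ζ‖_α + |ζ|)·
e^{−½δ₀d_T(y,y′)}|λ|` (§4, `Cα` the choice function of its constants, `|·|` to make it non-negative; `0` off `[0,1)`).
`M₁ := max`, `δ₀ := min` (rates weakened against the non-negative realised torus distance).  Non-vacuity beyond every
threshold: `kLevelTorusP_nonvacuous`, `kLevelTorusP_nonvacuous3` (torus (2.2) active), `kLevelTorusP_top` (`Ω_j = T_η`).
The torus twin of r03's `B6Prop22KLevelCensusEtaUnif.prop22Printed_kLevelP` (box family).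
[cite: Balaban1984PropagatorsII, Prop. 2.2 (2.67) p.234; (2.1)–(2.2) p.224 («we admit the case when some domains Ω_j are equal to T_η»); (2.46) p.231; Balaban1983RegularityDecay, Thm (1.9) p.573] -/
theorem prop22Printed_kLevelTorusP (d ℓ : ℕ) (hℓ : 1 ≤ ℓ) :
    Prop22Printed (fun i : KTIdx d ℓ => geoTP i) (fun i => gpTP i) := by
  classical
  obtain ⟨M₁, δ₁, C, hM₁, hδ₁, hC, hS⟩ := prop22_supEntries_kLevelTorusP d ℓ hℓ
  obtain ⟨M₂, δ₂, hM₂, hδ₂, hH⟩ := prop22_holderEntries_kLevelTorusP_unif d ℓ hℓ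
  -- the exponent-dependent constant: the absolute value of the one delivered by §4 on `[0, 1)`, `0` elsewhere
  let Cα : ℝ → ℝ := fun α => if h : 0 ≤ α ∧ α < 1 then |Classical.choose (hH α h.1 h.2)| else 0
  have hCα0 : ∀ α, 0 ≤ Cα α := by
    intro α
    by_cases h : 0 ≤ α ∧ α < 1
    · simp only [Cα, dif_pos h]; exact abs_nonneg _
    · simp only [Cα, dif_neg h]; exact le_rfl
  have hsup0 : ∀ (i : KTIdx d ℓ) (lam : (geoTP i).Loc), 0 ≤ (geoTP i).supNorm lam := fun i lam => supF_nonneg i lam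
  have hcut0 : ∀ (i : KTIdx d ℓ) (α : ℝ) (ζ : (geoTP i).Cut), 0 ≤ (geoTP i).cutH α ζ := by
    intro i α ζ
    change 0 ≤ hqTP i α ζ + i.supF ζ
    have := hqTP_nonneg i α ζ; have := supF_nonneg i ζ; positivity
  have hdist0 : ∀ (i : KTIdx d ℓ) (y y' : (geoTP i).Site), 0 ≤ (geoTP i).dist y y' := by
    intro i y y'
    change (0 : ℝ) ≤ (((bondT i.D).dist y y' : ℕ) : ℝ); exact Nat.cast_nonneg _
  have hEmono : ∀ (i : KTIdx d ℓ) (δ : ℝ) (y y' : (geoTP i).Site), min δ₁ δ₂ ≤ δ →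
      Real.exp (-(δ / 2 * (geoTP i).dist y y')) ≤ Real.exp (-(min δ₁ δ₂ / 2 * (geoTP i).dist y y')) := by
    intro i δ y y' hδ
    apply Real.exp_le_exp.2
    have := mul_le_mul_of_nonneg_right (div_le_div_of_nonneg_right hδ (by norm_num : (0 : ℝ) ≤ 2)) (hdist0 i y y')
    linarith
  have hCα : ∀ α (h0 : 0 ≤ α) (h1 : α < 1), ∀ i : KTIdx d ℓ, (geoTP i).Hyp21_22 → M₂ ≤ (geoTP i).M →
      ∀ (lam : (geoTP i).Loc) (ζ : (geoTP i).Cut) (y y' : (geoTP i).Site), (geoTP i).cutIn ζ y →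
        (geoTP i).suppIn lam y' →
        (gpTP i).h1 lam α ζ ≤ Cα α * ((geoTP i).len y) ^ (1 - α) * (geoTP i).cutH α ζ *
          Real.exp (-(δ₂ / 2 * (geoTP i).dist y y')) * (geoTP i).supNorm lam := by
    intro α h0 h1 i hHyp hM lam ζ y y' hcut hsupp
    have e : Cα α = |Classical.choose (hH α h0 h1)| := by
      simp only [Cα, dif_pos (And.intro h0 h1)]
    rw [e]
    have h := (Classical.choose_spec (hH α h0 h1)).2 i hHyp hM lam ζ y y' hcut hsupp
    refine h.trans ?_
    have hP : 0 ≤ ((geoTP i).len y) ^ (1 - α) * (geoTP i).cutH α ζ * Real.exp (-(δ₂ / 2 * (geoTP i).dist y y')) *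
        (geoTP i).supNorm lam := by
      have := hcut0 i α ζ; have := hsup0 i lam
      have : 0 ≤ ((geoTP i).len y) ^ (1 - α) := Real.rpow_nonneg (lenT_pos i y).le _
      positivity
    have := mul_le_mul_of_nonneg_right (le_abs_self (Classical.choose (hH α h0 h1))) hP
    calc Classical.choose (hH α h0 h1) * ((geoTP i).len y) ^ (1 - α) * (geoTP i).cutH α ζ *
          Real.exp (-(δ₂ / 2 * (geoTP i).dist y y')) * (geoTP i).supNorm lam
        = Classical.choose (hH α h0 h1) * (((geoTP i).len y) ^ (1 - α) * (geoTP i).cutH α ζ *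
          Real.exp (-(δ₂ / 2 * (geoTP i).dist y y')) * (geoTP i).supNorm lam) := by ring
      _ ≤ |Classical.choose (hH α h0 h1)| * (((geoTP i).len y) ^ (1 - α) * (geoTP i).cutH α ζ *
          Real.exp (-(δ₂ / 2 * (geoTP i).dist y y')) * (geoTP i).supNorm lam) := this
      _ = _ := by ring
  refine ⟨max M₁ M₂, min δ₁ δ₂, C, Cα, lt_max_of_lt_left hM₁, lt_min hδ₁ hδ₂, hC, ?_⟩
  intro i hHyp hM
  refine ⟨fun m lam y y' hsupp => ?_, fun α lam ζ y y' hα0 hα1 hcut hsupp => ?_⟩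
  · have h := hS i hHyp ((le_max_left _ _).trans hM) m lam y y' hsupp
    refine h.trans ?_
    have hp : 0 ≤ pref4 ((geoTP i).len y) m := by
      have := (lenT_pos i y).le
      fin_cases m <;> simp [pref4] <;> positivity
    exact mul_le_mul_of_nonneg_right (mul_le_mul_of_nonneg_left (hEmono i δ₁ y y' (min_le_left _ _)) (by positivity))
      (hsup0 i lam)
  · have h := hCα α hα0 hα1 i hHyp ((le_max_right _ _).trans hM) lam ζ y y' hcut hsupp
    refine h.trans ?_
    have hl : 0 ≤ ((geoTP i).len y) ^ (1 - α) := Real.rpow_nonneg (lenT_pos i y).le _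
    have h0 : 0 ≤ Cα α * ((geoTP i).len y) ^ (1 - α) * (geoTP i).cutH α ζ :=
      mul_nonneg (mul_nonneg (hCα0 α) hl) (hcut0 i α ζ)
    exact mul_le_mul_of_nonneg_right (mul_le_mul_of_nonneg_left (hEmono i δ₂ y y' (min_le_right _ _)) h0) (hsup0 i lam)

/-- **NON-VACUITY beyond every threshold** (file T8's witness read in print's units): for every `k ≥ 2` and every `M₁`
the torus family has a member with `k` levels, `M ≥ M₁`, `Hyp21_22`, and blocks at BOTH top levels `k` and `k − 1`.
[cite: Balaban1984PropagatorsII, Prop. 2.2 p.234 («M is sufficiently large»); (2.1)–(2.2) p.224] -/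
theorem kLevelTorusP_nonvacuous (d ℓ k : ℕ) (hk : 2 ≤ k) (M₁ : ℝ) :
    ∃ i : KTIdx d ℓ, i.k = k ∧ M₁ ≤ (geoTP i).M ∧ (geoTP i).Hyp21_22 ∧
      (∃ s : (geoTP i).Site, (geoTP i).scale s = k) ∧ (∃ s : (geoTP i).Site, (geoTP i).scale s = k - 1) :=
  kLevelTorus_nonvacuous d ℓ k hk M₁

/-- **NON-VACUITY WITH THE TORUS (2.2) ACTIVE** (file T8's three-level witness read in print's units): for every `k ≥ 3`
and every `M₁` a member with `M ≥ M₁` and blocks at the THREE levels `k`, `k − 1`, `k − 2`.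
[cite: Balaban1984PropagatorsII, (2.1)–(2.2) p.224, Prop. 2.2 p.234 («M is sufficiently large»)] -/
theorem kLevelTorusP_nonvacuous3 (d ℓ k : ℕ) (hk : 3 ≤ k) (M₁ : ℝ) :
    ∃ i : KTIdx d ℓ, i.k = k ∧ M₁ ≤ (geoTP i).M ∧ (geoTP i).Hyp21_22 ∧
      (∃ s : (geoTP i).Site, (geoTP i).scale s = k) ∧ (∃ s : (geoTP i).Site, (geoTP i).scale s = k - 1) ∧
        (∃ s : (geoTP i).Site, (geoTP i).scale s = k - 2) :=
  kLevelTorus_nonvacuous3 d ℓ k hk M₁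

/-- **PRINT'S ADMITTED MEMBER `Ω₁ = … = Ω_k = T_η` IS IN THE FAMILY** beyond every threshold (file T8's witness read in
print's units). [cite: Balaban1984PropagatorsII, (2.1) p.224 («we admit the case when some domains Ω_j are equal to T_η»)] -/
theorem kLevelTorusP_top (d ℓ k : ℕ) (hk : 1 ≤ k) (M₁ : ℝ) :
    ∃ i : KTIdx d ℓ, i.k = k ∧ M₁ ≤ (geoTP i).M ∧ (geoTP i).Hyp21_22 ∧ ∀ s : (geoTP i).Site, (geoTP i).scale s = k :=
  kLevelTorus_top d ℓ k hk M₁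

end Literature.MathematicalPhysics.QuantumFieldTheory.Balaban1983to89.B6Prop22KLevelTorusCensusEtaL0
end
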